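import Summits.Ventures.QEC.CircuitDistance.PortStructure
import HarnessLib

/-!
# P3-PORT (E1): sector KINDS and the x/z-independence of the simulation (cell `qec`, experiment CDX, seat qec-cdx-type-1)

* `XKind`/`ZKind` (42 + 42 kinds with a possibly non-zero column), `XKind.fault`/`ZKind.fault` (representative fault at a
  cycle and base index), `Fault.xKind`/`Fault.zKind`, the lists `Layer.all`, `IdleSlot.all`, `XKind.all`, `ZKind.all`,
  `monoList`;
* x/z-INDEPENDENCE machinery: `State.xHalf`/`State.zHalf`, `xHalf_applyEv`, `xHalf_simulate`, `xHalf_simulate_none`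
  (and `Z` mirrors) — ideal operations and injections act on the two halves independently.
The column consequences are `PortKindColumns.lean`.  Generic in `S`; nothing here asserts a value of `d_circ`.
-/

namespace Summit.Ventures.QEC.CircuitDistance

open Literature.InformationTheory.QuantumCodes

variable {ℓ m : ℕ}

/-! ## Kinds -/

/-- An `X`-SECTOR KIND: what of a fault matters for the `Z`-check detectors and the residual `X`-error, up to cycle and base
index — a CNOT layer with the `x`-bits of its two-qubit Pauli, an idle slot (Pauli with `x`-bit), an `InitZ` fault, a `MeasZ`
flip.  `12·3 + 4 + 2 = 42` kinds carry a possibly non-zero column (`cnot lay false false` is the zero column). -/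
inductive XKind
  | cnot (lay : Layer) (bc bt : Bool)
  | idle (s : IdleSlot)
  | initZ
  | measZ
  deriving DecidableEq, Repr

/-- A `Z`-SECTOR KIND (mirror: `z`-bits, `InitX`, `MeasX`). -/
inductive ZKind
  | cnot (lay : Layer) (bc bt : Bool)
  | idle (s : IdleSlot)
  | initX
  | measX
  deriving DecidableEq, Repr

/-- The twelve CNOT layers, listed. -/
def Layer.all : List Layer := [.A1RZ, .A2XL, .A3RZ, .B2XR, .B1LZ, .B1XR, .B2LZ, .B3XR, .B3LZ, .A1XL, .A2RZ, .A3XL]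

/-- The four idle slots, listed. -/
def IdleSlot.all : List IdleSlot := [.L1, .R7, .L8, .R8]

/-- All `X`-kinds with a possibly non-zero column (42), listed. -/
def XKind.all : List XKind :=
  (Layer.all.flatMap fun lay => [.cnot lay true false, .cnot lay false true, .cnot lay true true]) ++
  (IdleSlot.all.map .idle) ++ [.initZ, .measZ]

/-- All `Z`-kinds with a possibly non-zero column (42), listed. -/
def ZKind.all : List ZKind :=
  (Layer.all.flatMap fun lay => [.cnot lay true false, .cnot lay false true, .cnot lay true true]) ++
  (IdleSlot.all.map .idle) ++ [.initX, .measX]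

/-- The list of `X`-kinds is complete up to the zero kinds. -/
theorem XKind.mem_all (k : XKind) (h : ∀ lay, k ≠ .cnot lay false false) : k ∈ XKind.all := by
  cases k with
  | cnot lay bc bt =>
    have := h lay
    cases lay <;> cases bc <;> cases bt <;> simp_all [XKind.all, Layer.all, IdleSlot.all]
  | idle s => cases s <;> simp [XKind.all, Layer.all, IdleSlot.all]
  | initZ => simp [XKind.all]
  | measZ => simp [XKind.all]

/-- The list of `Z`-kinds is complete up to the zero kinds. -/
theorem ZKind.mem_all (k : ZKind) (h : ∀ lay, k ≠ .cnot lay false false) : k ∈ ZKind.all := by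
  cases k with
  | cnot lay bc bt =>
    have := h lay
    cases lay <;> cases bc <;> cases bt <;> simp_all [ZKind.all, Layer.all, IdleSlot.all]
  | idle s => cases s <;> simp [ZKind.all, Layer.all, IdleSlot.all]
  | initX => simp [ZKind.all]
  | measX => simp [ZKind.all]

/-- All elements of `ℤ_ℓ × ℤ_m`, listed (computably). -/
def monoList (ℓ m : ℕ) : List (BB.Mono ℓ m) := (List.finRange ℓ).flatMap fun a => (List.finRange m).map fun b => (a, b)

/-- The list is complete. -/
theorem mem_monoList (i : BB.Mono ℓ m) : i ∈ monoList ℓ m := by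
  unfold monoList; rw [List.mem_flatMap]; exact ⟨i.1, List.mem_finRange _, List.mem_map.2 ⟨i.2, List.mem_finRange _, rfl⟩⟩

/-- The representative fault of an `X`-kind at cycle `c`, base index `i`. -/
def XKind.fault (k : XKind) (c : ℕ) (i : BB.Mono ℓ m) : Fault ℓ m :=
  match k with
  | .cnot lay bc bt => .cnot c lay i (bc, false) (bt, false)
  | .idle s => .idle c s i (true, false)
  | .initZ => .initZ c i
  | .measZ => .measZ c i

/-- The representative fault of a `Z`-kind. -/
def ZKind.fault (k : ZKind) (c : ℕ) (i : BB.Mono ℓ m) : Fault ℓ m :=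
  match k with
  | .cnot lay bc bt => .cnot c lay i (false, bc) (false, bt)
  | .idle s => .idle c s i (false, true)
  | .initX => .initX c i
  | .measX => .measX c i

/-- The `X`-kind and base index of a fault; `none` = the fault has a zero `X`-sector column. -/
def Fault.xKind : Fault ℓ m → Option (XKind × BB.Mono ℓ m)
  | .cnot _ lay i pc pt => if pc.1 || pt.1 then some (.cnot lay pc.1 pt.1, i) else none
  | .idle _ s i p => if p.1 then some (.idle s, i) else none
  | .initX _ _ => none
  | .measX _ _ => none
  | .initZ _ i => some (.initZ, i)
  | .measZ _ i => some (.measZ, i)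

/-- The `Z`-kind and base index of a fault. -/
def Fault.zKind : Fault ℓ m → Option (ZKind × BB.Mono ℓ m)
  | .cnot _ lay i pc pt => if pc.2 || pt.2 then some (.cnot lay pc.2 pt.2, i) else none
  | .idle _ s i p => if p.2 then some (.idle s, i) else none
  | .initX _ i => some (.initX, i)
  | .measX _ i => some (.measX, i)
  | .initZ _ _ => none
  | .measZ _ _ => none

/-- The cycle of a representative. -/
@[simp] theorem XKind.cyc_fault (k : XKind) (c : ℕ) (i : BB.Mono ℓ m) : (k.fault c i).cyc = c := by cases k <;> rfl

/-- The cycle of a representative. -/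
@[simp] theorem ZKind.cyc_fault (k : ZKind) (c : ℕ) (i : BB.Mono ℓ m) : (k.fault c i).cyc = c := by cases k <;> rfl

/-- Kinds produced by `xKind` are never the zero kind. -/
theorem Fault.xKind_ne_zero {f : Fault ℓ m} {k : XKind} {i : BB.Mono ℓ m} (h : f.xKind = some (k, i)) (lay : Layer) :
    k ≠ .cnot lay false false := by
  cases f <;> simp [Fault.xKind] at h
  all_goals first
    | (obtain ⟨h1, h2, -⟩ := h; rw [← h2]; intro e; injection e with _ e1 e2; simp_all)
    | (obtain ⟨-, h2, -⟩ := h; rw [← h2]; simp)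
    | (rw [← h.1]; simp)

/-- Kinds produced by `zKind` are never the zero kind. -/
theorem Fault.zKind_ne_zero {f : Fault ℓ m} {k : ZKind} {i : BB.Mono ℓ m} (h : f.zKind = some (k, i)) (lay : Layer) :
    k ≠ .cnot lay false false := by
  cases f <;> simp [Fault.zKind] at h
  all_goals first
    | (obtain ⟨h1, h2, -⟩ := h; rw [← h2]; intro e; injection e with _ e1 e2; simp_all)
    | (obtain ⟨-, h2, -⟩ := h; rw [← h2]; simp)
    | (rw [← h.1]; simp)

/-- The representative of a fault's `X`-kind sits on the same event. -/
theorem Fault.ev_xKind {f : Fault ℓ m} {k : XKind} {i : BB.Mono ℓ m} (h : f.xKind = some (k, i)) :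
    f.ev = (k.fault f.cyc i).ev := by
  cases f with
  | cnot c lay i' pc pt =>
    simp only [Fault.xKind] at h
    split_ifs at h
    obtain ⟨rfl, rfl⟩ := Prod.mk.inj (Option.some_injective _ h); rfl
  | idle c s i' p =>
    simp only [Fault.xKind] at h
    split_ifs at h
    obtain ⟨rfl, rfl⟩ := Prod.mk.inj (Option.some_injective _ h); rfl
  | initX c i' => simp [Fault.xKind] at h
  | measX c i' => simp [Fault.xKind] at h
  | initZ c i' =>
    simp only [Fault.xKind, Option.some.injEq, Prod.mk.injEq] at h
    obtain ⟨rfl, rfl⟩ := h; rfl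
  | measZ c i' =>
    simp only [Fault.xKind, Option.some.injEq, Prod.mk.injEq] at h
    obtain ⟨rfl, rfl⟩ := h; rfl

/-- The representative of a fault's `Z`-kind sits on the same event. -/
theorem Fault.ev_zKind {f : Fault ℓ m} {k : ZKind} {i : BB.Mono ℓ m} (h : f.zKind = some (k, i)) :
    f.ev = (k.fault f.cyc i).ev := by
  cases f with
  | cnot c lay i' pc pt =>
    simp only [Fault.zKind] at h
    split_ifs at h
    obtain ⟨rfl, rfl⟩ := Prod.mk.inj (Option.some_injective _ h); rfl
  | idle c s i' p =>
    simp only [Fault.zKind] at h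
    split_ifs at h
    obtain ⟨rfl, rfl⟩ := Prod.mk.inj (Option.some_injective _ h); rfl
  | initZ c i' => simp [Fault.zKind] at h
  | measZ c i' => simp [Fault.zKind] at h
  | initX c i' =>
    simp only [Fault.zKind, Option.some.injEq, Prod.mk.injEq] at h
    obtain ⟨rfl, rfl⟩ := h; rfl
  | measX c i' =>
    simp only [Fault.zKind, Option.some.injEq, Prod.mk.injEq] at h
    obtain ⟨rfl, rfl⟩ := h; rfl

variable [NeZero ℓ] [NeZero m]

/-! ## x/z-independence -/

/-- The `X`-half of a state: `x`-bits of the frame and `Z`-check outcome flips. -/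
def State.xHalf (st : State ℓ m) : (Qubit ℓ m → Bool) × (ℕ → BB.Mono ℓ m → Bool) := (fun q => (st.frame q).1, st.mZ)

/-- The `Z`-half of a state: `z`-bits of the frame and `X`-check outcome flips. -/
def State.zHalf (st : State ℓ m) : (Qubit ℓ m → Bool) × (ℕ → BB.Mono ℓ m → Bool) := (fun q => (st.frame q).2, st.mX)

/-- Ideal operations act on the `X`-half independently. -/
theorem xHalf_applyEv (S : SMCode ℓ m) (e : Ev) {st st' : State ℓ m} (h : st.xHalf = st'.xHalf) :
    (applyEv S e st).xHalf = (applyEv S e st').xHalf := by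
  have hf : ∀ q, (st.frame q).1 = (st'.frame q).1 := fun q => congrFun (congrArg Prod.fst h) q
  have hm : st.mZ = st'.mZ := congrArg Prod.snd h
  cases e with
  | cnot c lay =>
    simp only [applyEv, State.xHalf, Prod.mk.injEq]
    refine ⟨?_, hm⟩
    funext q; simp only [Frame.cnotLayer]; split_ifs <;> simp [hf]
  | measX c => simp only [applyEv, State.xHalf, Prod.mk.injEq]; exact ⟨funext hf, hm⟩
  | measZ c =>
    simp only [applyEv, State.xHalf, Prod.mk.injEq]
    refine ⟨funext hf, ?_⟩
    funext c' i; simp only [hm, hf]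
  | initX c =>
    simp only [applyEv, State.xHalf, Prod.mk.injEq]
    refine ⟨?_, hm⟩
    funext q; simp only [Frame.clearReg]; split_ifs <;> simp [hf]
  | initZ c =>
    simp only [applyEv, State.xHalf, Prod.mk.injEq]
    refine ⟨?_, hm⟩
    funext q; simp only [Frame.clearReg]; split_ifs <;> simp [hf]
  | idle c s => simp only [applyEv, State.xHalf, Prod.mk.injEq]; exact ⟨funext hf, hm⟩

/-- Ideal operations act on the `Z`-half independently. -/
theorem zHalf_applyEv (S : SMCode ℓ m) (e : Ev) {st st' : State ℓ m} (h : st.zHalf = st'.zHalf) :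
    (applyEv S e st).zHalf = (applyEv S e st').zHalf := by
  have hf : ∀ q, (st.frame q).2 = (st'.frame q).2 := fun q => congrFun (congrArg Prod.fst h) q
  have hm : st.mX = st'.mX := congrArg Prod.snd h
  cases e with
  | cnot c lay =>
    simp only [applyEv, State.zHalf, Prod.mk.injEq]
    refine ⟨?_, hm⟩
    funext q; simp only [Frame.cnotLayer]; split_ifs <;> simp [hf]
  | measZ c => simp only [applyEv, State.zHalf, Prod.mk.injEq]; exact ⟨funext hf, hm⟩
  | measX c =>
    simp only [applyEv, State.zHalf, Prod.mk.injEq]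
    refine ⟨funext hf, ?_⟩
    funext c' i; simp only [hm, hf]
  | initX c =>
    simp only [applyEv, State.zHalf, Prod.mk.injEq]
    refine ⟨?_, hm⟩
    funext q; simp only [Frame.clearReg]; split_ifs <;> simp [hf]
  | initZ c =>
    simp only [applyEv, State.zHalf, Prod.mk.injEq]
    refine ⟨?_, hm⟩
    funext q; simp only [Frame.clearReg]; split_ifs <;> simp [hf]
  | idle c s => simp only [applyEv, State.zHalf, Prod.mk.injEq]; exact ⟨funext hf, hm⟩

/-- Fault-free evolution acts on the `X`-half independently. -/
theorem xHalf_evolve (S : SMCode ℓ m) (es : List Ev) {st st' : State ℓ m} (h : st.xHalf = st'.xHalf) :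
    (evolve S es st).xHalf = (evolve S es st').xHalf := by
  induction es generalizing st st' with
  | nil => exact h
  | cons e es ih => simp only [evolve_cons]; exact ih (xHalf_applyEv S e h)

/-- Fault-free evolution acts on the `Z`-half independently. -/
theorem zHalf_evolve (S : SMCode ℓ m) (es : List Ev) {st st' : State ℓ m} (h : st.zHalf = st'.zHalf) :
    (evolve S es st).zHalf = (evolve S es st').zHalf := by
  induction es generalizing st st' with
  | nil => exact h
  | cons e es ih => simp only [evolve_cons]; exact ih (zHalf_applyEv S e h)

/-- Two faults with the same event whose injections agree on `X`-halves have runs agreeing on `X`-halves. -/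
theorem xHalf_simulate (S : SMCode ℓ m) {f g : Fault ℓ m} (hev : f.ev = g.ev)
    (hinj : ∀ st st' : State ℓ m, st.xHalf = st'.xHalf → (inject S f st).xHalf = (inject S g st').xHalf)
    (es : List Ev) {st st' : State ℓ m} (h : st.xHalf = st'.xHalf) :
    (simulate S f es st).xHalf = (simulate S g es st').xHalf := by
  induction es generalizing st st' with
  | nil => exact h
  | cons e es ih =>
    rw [simulate_cons, simulate_cons, ← hev]
    by_cases he : e = f.ev
    · rw [if_pos he, if_pos he]; exact ih (hinj _ _ (xHalf_applyEv S e h))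
    · rw [if_neg he, if_neg he]; exact ih (xHalf_applyEv S e h)

/-- Mirror. -/
theorem zHalf_simulate (S : SMCode ℓ m) {f g : Fault ℓ m} (hev : f.ev = g.ev)
    (hinj : ∀ st st' : State ℓ m, st.zHalf = st'.zHalf → (inject S f st).zHalf = (inject S g st').zHalf)
    (es : List Ev) {st st' : State ℓ m} (h : st.zHalf = st'.zHalf) :
    (simulate S f es st).zHalf = (simulate S g es st').zHalf := by
  induction es generalizing st st' with
  | nil => exact h
  | cons e es ih =>
    rw [simulate_cons, simulate_cons, ← hev]
    by_cases he : e = f.ev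
    · rw [if_pos he, if_pos he]; exact ih (hinj _ _ (zHalf_applyEv S e h))
    · rw [if_neg he, if_neg he]; exact ih (zHalf_applyEv S e h)

/-- A fault whose injection does not touch the `X`-half has a run with the all-clear `X`-half. -/
theorem xHalf_simulate_none (S : SMCode ℓ m) {f : Fault ℓ m}
    (hinj : ∀ st : State ℓ m, (inject S f st).xHalf = st.xHalf) (es : List Ev) {st st' : State ℓ m}
    (h : st.xHalf = st'.xHalf) : (simulate S f es st).xHalf = (evolve S es st').xHalf := by
  induction es generalizing st st' with
  | nil => exact h
  | cons e es ih =>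
    rw [simulate_cons, evolve_cons]
    by_cases he : e = f.ev
    · rw [if_pos he]; exact ih ((hinj _).trans (xHalf_applyEv S e h))
    · rw [if_neg he]; exact ih (xHalf_applyEv S e h)

/-- Mirror. -/
theorem zHalf_simulate_none (S : SMCode ℓ m) {f : Fault ℓ m}
    (hinj : ∀ st : State ℓ m, (inject S f st).zHalf = st.zHalf) (es : List Ev) {st st' : State ℓ m}
    (h : st.zHalf = st'.zHalf) : (simulate S f es st).zHalf = (evolve S es st').zHalf := by
  induction es generalizing st st' with
  | nil => exact h
  | cons e es ih =>
    rw [simulate_cons, evolve_cons]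
    by_cases he : e = f.ev
    · rw [if_pos he]; exact ih ((hinj _).trans (zHalf_applyEv S e h))
    · rw [if_neg he]; exact ih (zHalf_applyEv S e h)

end Summit.Ventures.QEC.CircuitDistance
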